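import Summits.NavierStokesRegularity.NavierStokesRegularity.Theses.TypeICertificateLadder

/-!
# Route TypeICertificateLadder — Assembly (item stmt-NavierStokesRegularity-2888)

The assembly item of route `TypeICertificateLadder` for `NavierStokesRegularity` (Clay (A)):

`NoTypeIBlowup → NoTypeII → NoBlowupToClay → NavierStokesRegularity`.

Pure bookkeeping (Fefferman 2000 is only the problem statement): `NoBlowupToClay`
(stmt-NavierStokesRegularity-0055) reduces Clay (A) to "every classical Leray–Hopf solution on
`[0, T)` from a rapidly decaying datum extends smoothly past `T`"; a solution that did not extend
would be a maximal smooth solution (`IsMaximalSmoothSolution` := classical on `Ico 0 T` ∧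
`¬ HasSmoothExtensionPast`), hence Type I by `NoTypeII` (stmt-NavierStokesRegularity-0056), hence
it extends by `NoTypeIBlowup` (stmt-NavierStokesRegularity-1217) — contradiction. This is
literally the type of the route file's sorry-free deciding theorem
`Summit.NavierStokesRegularity.NavierStokesRegularity.Theses.TypeICertificateLadder.closes`
(as of the route revision at which this file landed: item stmt-NavierStokesRegularity-2888).

**Repair 2026-08-16.** A later route repair restated the item UNDER THE SAME DECL NAME `Assembly`
as the INLINED ladder frame (the three crux statements written out), already closed by the
cycle-free `Theorems.typeICertificateLadder_ladderAssembly` (`TypeICertificateLadderLadderAssembly.lean`,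
imported by the route file); `exact closes` therefore stopped elaborating ("Type mismatch", full
builds of 2026-08-16). The theorem keeps its name and statement text (Theorems files are
append-only) and now proves the current `Assembly` by that landed ladder proof — a second, dependent
proof that must NOT serve as the item's `Assembly_holds` link (this module imports the route module).
-/

namespace Summit.NavierStokesRegularity.NavierStokesRegularity.Theorems

/-- **Assembly of route TypeICertificateLadder** (item stmt-NavierStokesRegularity-2888):
`NoTypeIBlowup → NoTypeII → NoBlowupToClay → NavierStokesRegularity` (now the same frame with the
three statements inlined, same decl name — see the module docstring). Proof: unfold `Assembly`
and apply the landed ladder proof `typeICertificateLadder_ladderAssembly`, i.e. the argument of the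
route's deciding theorem `Theses.TypeICertificateLadder.closes` (a non-extending
classical Leray–Hopf solution is maximal, hence Type I by `NoTypeII`, hence extends by
`NoTypeIBlowup`; `NoBlowupToClay` converts no-blow-up into Clay (A)). -/
theorem typeICertificateLadder_assembly_proof :
    Summit.NavierStokesRegularity.NavierStokesRegularity.Theses.TypeICertificateLadder.Assembly := by
  unfold Summit.NavierStokesRegularity.NavierStokesRegularity.Theses.TypeICertificateLadder.Assembly
  -- current `Assembly` = the inlined ladder frame, proved cycle-free in `TypeICertificateLadderLadderAssembly`
  exact Summit.NavierStokesRegularity.NavierStokesRegularity.Theorems.typeICertificateLadder_ladderAssembly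

end Summit.NavierStokesRegularity.NavierStokesRegularity.Theorems
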